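import Mathlib.Data.Fin.Tuple.Sort
import Summits.CriticalPhenomena.PercolationContinuityZ3.Theorems.PercNearOneGluingNoHeavyLowerTailSahiGridPatternFlattening
import Summits.CriticalPhenomena.PercolationContinuityZ3.Theorems.PercNearOneGluingNoHeavyLowerTailSahiPair43LinkNodePrelim

/-!
# `NoHeavyLowerTail` (crux stmt-CriticalPhenomena-4575), Sahi programme: the cell `(4,3)` — **link, symmetries**: swapping the two sets
# and permuting the axes

Support file (Sahi cell `prim-sahi`, seat `prim-sahi-typer` gen 32; `--supports stmt-CriticalPhenomena-4575`).  Pure proofs; no `sorry`,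
standard axioms.

* swap: `yProfile_swap`, `inDual_swap`, `pairCond_swap`;
* axis permutations `compEquivD τ`: `pairCond_map` (co-generators, minimal elements, freeness, antichains are transported), `inDual_of_map`
  (via `sStarD_map_compEquivD`), and the signature `sigP_map` (`hs` is `S₄`-invariant, `hs_comp`) — so that `Tuple.sort` of the signature
  vector puts every pair into the symmetry normal form examined by the checker (`…LinkFinal`). [this work]
-/

namespace Summit.CriticalPhenomena.PercolationContinuityZ3.Theorems.SahiGridPattern.Pair43

open Finset SahiGrid3 SahiGridPattern
open scoped BigOperators

/-! ### Swapping the two sets -/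

/-- The y-profile is symmetric in the two sets. [this work] -/
theorem yProfile_swap (A B : Finset (Pd 4)) (y : Pd 4) : yProfile A B y = yProfile B A y := by
  unfold yProfile
  rw [Finset.sum_comm]
  exact Finset.sum_congr rfl fun p _ => Finset.sum_congr rfl fun q _ => tcD_swap12 p q y

/-- `InDual ∘ yProfile` is symmetric. [this work] -/
theorem inDual_swap {A B : Finset (Pd 4)} (h : InDual (yProfile A B)) : InDual (yProfile B A) := by
  have e : yProfile B A = yProfile A B := funext fun y => (yProfile_swap A B y).symm
  rw [e]; exact h

/-- `PairCond` is symmetric. [this work] -/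
theorem pairCond_swap {A B : Finset (Pd 4)} (h : PairCond A B) : PairCond B A where
  upA := h.upB
  upB := h.upA
  genA := h.genB
  genB := h.genA
  minA := fun m hm hmA => by rw [union_comm]; exact h.minB m hm hmA
  minB := fun m hm hmB => by rw [union_comm]; exact h.minA m hm hmB
  big := by
    obtain ⟨Q, hQ, ha, hcA, hcB⟩ := h.big
    exact ⟨Q, fun q hq => by rw [union_comm]; exact hQ q hq, ha, hcB, hcA⟩

/-! ### Axis permutations -/

section Perm

variable (τ : Equiv.Perm (Fin 4))

/-- Axis permutations preserve the order. [this work] -/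
theorem compEquivD_le_iff (p q : Pd 4) : compEquivD τ p ≤ compEquivD τ q ↔ p ≤ q := by
  show (p ∘ τ ≤ q ∘ τ) ↔ p ≤ q
  constructor
  · intro h a; have := h (τ.symm a); simpa using this
  · intro h a; exact h (τ a)

/-- … and the strict order. [this work] -/
theorem compEquivD_lt_iff (p q : Pd 4) : compEquivD τ p < compEquivD τ q ↔ p < q := by
  rw [lt_iff_le_and_ne, lt_iff_le_and_ne, compEquivD_le_iff, (compEquivD τ).injective.ne_iff]

/-- The inverse also preserves the order. [this work] -/
theorem compEquivD_symm_le_iff (p q : Pd 4) : (compEquivD τ).symm p ≤ (compEquivD τ).symm q ↔ p ≤ q := by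
  rw [← compEquivD_le_iff τ, Equiv.apply_symm_apply, Equiv.apply_symm_apply]

/-- … and so does its strict version. [this work] -/
theorem compEquivD_symm_lt_iff (p q : Pd 4) : (compEquivD τ).symm p < (compEquivD τ).symm q ↔ p < q := by
  rw [lt_iff_le_and_ne, lt_iff_le_and_ne, compEquivD_symm_le_iff, (compEquivD τ).symm.injective.ne_iff]

/-- Co-generators are transported. [this work] -/
theorem mem_coGen_map {A : Finset (Pd 4)} {x : Pd 4} :
    x ∈ coGen (A.map (compEquivD τ).toEmbedding) ↔ (compEquivD τ).symm x ∈ coGen A := by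
  rw [mem_coGen, mem_coGen, Finset.mem_map_equiv]
  refine and_congr Iff.rfl ⟨fun h y hy => ?_, fun h y hy => ?_⟩
  · have := h (compEquivD τ y) (by rw [← compEquivD_symm_lt_iff τ, Equiv.symm_apply_apply]; exact hy)
    rwa [Finset.mem_map_equiv, Equiv.symm_apply_apply] at this
  · rw [Finset.mem_map_equiv]
    exact h _ ((compEquivD_symm_lt_iff τ x y).2 hy)

/-- Co-generators of the image. [this work] -/
theorem coGen_map (A : Finset (Pd 4)) : coGen (A.map (compEquivD τ).toEmbedding) = (coGen A).map (compEquivD τ).toEmbedding := by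
  ext x; rw [mem_coGen_map, Finset.mem_map_equiv]

/-- Minimal elements are transported. [this work] -/
theorem mem_minEl_map {A : Finset (Pd 4)} {x : Pd 4} :
    x ∈ minEl (A.map (compEquivD τ).toEmbedding) ↔ (compEquivD τ).symm x ∈ minEl A := by
  rw [mem_minEl, mem_minEl, Finset.mem_map_equiv]
  refine and_congr Iff.rfl ⟨fun h y hy => ?_, fun h y hy => ?_⟩
  · have := h (compEquivD τ y) (by rw [← compEquivD_symm_lt_iff τ, Equiv.symm_apply_apply]; exact hy)
    rwa [Finset.mem_map_equiv, Equiv.symm_apply_apply] at this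
  · rw [Finset.mem_map_equiv]
    exact h _ ((compEquivD_symm_lt_iff τ y x).2 hy)

/-- Freeness is transported. [this work] -/
theorem free_map {N : Finset (Pd 4)} {m : Pd 4} : Free (N.map (compEquivD τ).toEmbedding) m ↔ Free N ((compEquivD τ).symm m) := by
  unfold Free
  constructor
  · intro h z hz
    have := h (compEquivD τ z) (by rw [Finset.mem_map_equiv, Equiv.symm_apply_apply]; exact hz)
    rw [← compEquivD_symm_le_iff τ, ← compEquivD_symm_le_iff τ (compEquivD τ z), Equiv.symm_apply_apply] at this
    exact this
  · intro h z hz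
    have := h ((compEquivD τ).symm z) (Finset.mem_map_equiv.1 hz)
    rw [compEquivD_symm_le_iff, compEquivD_symm_le_iff] at this
    exact this

/-- **`PairCond` is transported along axis permutations.** [this work] -/
theorem pairCond_map {A B : Finset (Pd 4)} (h : PairCond A B) : PairCond (A.map (compEquivD τ).toEmbedding) (B.map (compEquivD τ).toEmbedding) where
  upA := isUpperSet_map_compEquivD τ h.upA
  upB := isUpperSet_map_compEquivD τ h.upB
  genA := by rw [coGen_map]; exact Finset.map_subset_map.2 h.genA
  genB := by rw [coGen_map]; exact Finset.map_subset_map.2 h.genB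
  minA := by
    intro m hm hmB
    rw [coGen_map, coGen_map, ← Finset.map_union, free_map]
    exact h.minA _ ((mem_minEl_map τ).1 hm) (Finset.mem_map_equiv.1 hmB)
  minB := by
    intro m hm hmA
    rw [coGen_map, coGen_map, ← Finset.map_union, free_map]
    exact h.minB _ ((mem_minEl_map τ).1 hm) (Finset.mem_map_equiv.1 hmA)
  big := by
    obtain ⟨Q, hQ, hanti, hcA, hcB⟩ := h.big
    refine ⟨Q.map (compEquivD τ).toEmbedding, fun q hq => ?_, ?_, ?_, ?_⟩
    · rw [coGen_map, coGen_map, ← Finset.map_union, free_map]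
      exact hQ _ (Finset.mem_map_equiv.1 hq)
    · intro x hx y hy hne hle
      rw [Finset.coe_map] at hx hy
      obtain ⟨x', hx', rfl⟩ := hx
      obtain ⟨y', hy', rfl⟩ := hy
      have hle' : x' ≤ y' := (compEquivD_le_iff τ x' y').1 hle
      exact hanti hx' hy' (fun e => hne (by rw [e])) hle'
    · rw [coGen_map, Finset.card_map, Finset.card_map]; exact hcA
    · rw [coGen_map, Finset.card_map, Finset.card_map]; exact hcB

/-- `InDual ∘ yProfile` in terms of `sStarD`. [this work] -/
theorem inDual_iff_sStarD (A B : Finset (Pd 4)) :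
    InDual (yProfile A B) ↔ ∀ U : Finset (Pd 4), IsUpperSet (U : Set (Pd 4)) → 0 ≤ sStarD A B U := by
  refine forall_congr' fun U => imp_congr_right fun _ => ?_
  rw [sStarD_eq_sum_yProfile]

/-- **`InDual ∘ yProfile` is transported back along axis permutations.** [this work] -/
theorem inDual_of_map {A B : Finset (Pd 4)} (h : InDual (yProfile (A.map (compEquivD τ).toEmbedding) (B.map (compEquivD τ).toEmbedding))) : InDual (yProfile A B) := by
  rw [inDual_iff_sStarD] at h ⊢
  intro U hU
  rw [← sStarD_map_compEquivD τ A B U]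
  exact h _ (isUpperSet_map_compEquivD τ hU)

/-! ### The signature under axis permutations -/

/-- `countBelow 4`, unfolded. [this work] -/
theorem countBelow_four (g : ℕ → Bool) : countBelow 4 g =
    0 + (if g 0 = true then 1 else 0) + (if g 1 = true then 1 else 0) + (if g 2 = true then 1 else 0) +
      (if g 3 = true then 1 else 0) := rfl

/-- The `S₄`-invariant weight of a point in terms of its coordinates. [this work] -/
theorem hs_eq (p : Pd 4) : hs (enc p) = (1 + ∑ a : Fin 4, if (p a : ℕ) = 1 then 1 else 0) +
    16 * (1 + ∑ a : Fin 4, if (p a : ℕ) = 2 then 1 else 0) := by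
  unfold hs
  rw [countBelow_four, countBelow_four, Fin.sum_univ_four, Fin.sum_univ_four, dg_enc0, dg_enc1, dg_enc2, dg_enc3]
  simp only [beq_iff_eq, Nat.zero_add]

/-- **`hs` is invariant under axis permutations.** [this work] -/
theorem hs_comp (p : Pd 4) : hs (enc (p ∘ τ)) = hs (enc p) := by
  rw [hs_eq, hs_eq]
  have e1 : (∑ a : Fin 4, if ((p ∘ τ) a : ℕ) = 1 then 1 else 0) = ∑ a : Fin 4, if (p a : ℕ) = 1 then 1 else 0 :=
    Equiv.sum_comp τ (fun a => if (p a : ℕ) = 1 then 1 else 0)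
  have e2 : (∑ a : Fin 4, if ((p ∘ τ) a : ℕ) = 2 then 1 else 0) = ∑ a : Fin 4, if (p a : ℕ) = 2 then 1 else 0 :=
    Equiv.sum_comp τ (fun a => if (p a : ℕ) = 2 then 1 else 0)
  rw [e1, e2]

/-- **The signature of the image is the permuted signature.** [this work] -/
theorem sigP_map (a : Fin 4) (S : Finset (Pd 4)) : sigP a (S.map (compEquivD τ).toEmbedding) = sigP (τ a) S := by
  unfold sigP
  rw [Finset.sum_map]
  refine Finset.sum_congr rfl fun p _ => ?_
  show sw a (enc (p ∘ τ)) = sw (τ a) (enc p)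
  rw [sw_enc a (p ∘ τ), sw_enc (τ a) p, hs_comp]
  rfl

end Perm

end Summit.CriticalPhenomena.PercolationContinuityZ3.Theorems.SahiGridPattern.Pair43
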